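import Summits.RiemannHypothesis.RiemannHypothesis.Theorems.SemilocalDeletionToeplitzFloor
import Summits.RiemannHypothesis.RiemannHypothesis.Theorems.SemilocalDeletionDipole
import Summits.RiemannHypothesis.RiemannHypothesis.Theorems.HandoffSemilocalParitySplit
import Literature.NumberTheory.LFunctions.WeilSmallSupportPositivity
import Literature.NumberTheory.LFunctions.WeilWindowSimpleEven
import Literature.NumberTheory.LFunctions.WeilMellinBounds
import HarnessLib

/-!
# The Toeplitz HALF-ROOM LAW for two visible powers: `λ_min(S∖p; log p + δ) ≤ −μ₂(p) + 4·λ_min(S; δ)` under one rung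

The CONVERGENCE half of the Toeplitz law for `m = 2` (`SemilocalDeletionToeplitzFloorTwo` has the floor `≥ λ_min(S) − μ₂(p)`,
`μ₂(p) = (log p/(2p))(√(1+8p) − 1)` = minus the bottom eigenvalue of `A₂(p) = [[0,w₁,w₂],[w₁,0,w₁],[w₂,w₁,0]]`; `SemilocalDeletionDipoleHalfRoom`
is `m = 1`).  On the window `c = log p + δ` (`0 < δ`, `2δ < log p`: exactly `p, p²` visible), if `Q_S ≥ 0` on `C(log p + δ)` (one rung when
`S` holds every visible prime), the three-block COMB `g = h(· + L) − βh + h(· − L)` of a block `h ∈ C(δ)` along the bottom eigenvector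
`(1, −β, 1)`, `β = 2w₁/μ₂`, has `Q_{S∖p}(g) = Q_S(g) − μ₂‖g‖₂²` exactly (`weilSemilocalQuadratic_sub_erase_pow` + the comb's autocorrelations
at `±L, ±2L`, §2) and `Re Q_S(g) ≤ 4‖g‖₂²·Re Q_S(h)/‖h‖₂²` (parallelogram law twice + positivity).  Hence (§3)
**`λ_min(S∖{p}; log p + δ; σ) ≤ −μ₂(p) + 4·λ_min(S; δ; σ)`** for `σ` = all / even / odd — NO parity swap (the bottom eigenvector of `A₂` is
reversal-symmetric: even blocks give even combs; the data's «even sector fast for even m»).  With the floor: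
`λ_min(S∖p; log p + δ; σ) ∈ [−μ₂(p), −μ₂(p) + 4ε^S_σ(δ)]` — lineage E's `λ(U(b)∖{p}) = −μ₂(p) + Δ`, `0 ≤ Δ → 0` (p = 3: `1.6e−6` at `b = 1.55`;
p = 5: `3.3e−5` at `b = 2`, BLIND) is a two-sided theorem up to the constant (`Δ/ε` measured `1/25 … 1/3`).  Nothing here bears on RH.
-/

set_option linter.dupNamespace false

noncomputable section

open Complex Filter Set MeasureTheory
open scoped Real Topology ComplexConjugate

namespace Summit.RiemannHypothesis.RiemannHypothesis.Theorems.SemilocalDeletionToeplitzHalfRoom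

open Literature.NumberTheory.LFunctions
open Summit.RiemannHypothesis.RiemannHypothesis.Theorems.HandoffSemilocalEnergy
open Summit.RiemannHypothesis.RiemannHypothesis.Theorems.HandoffSemilocalParitySplit
open Summit.RiemannHypothesis.RiemannHypothesis.Theorems.SemilocalDeletionToeplitzFloor

variable {h f g : ℝ → ℂ} {S : Finset ℕ} {p : ℕ} {δ L c : ℝ} {P : (ℝ → ℂ) → Prop}

/-! ## §1  Tools: `Q_S` under positivity is sub-additive up to a factor 2; far blocks do not interact -/

/-- A function vanishing outside `[a, b]` has `tsupport ⊆ [a, b]`. -/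
theorem tsupport_subset_Icc_of_apply {F : ℝ → ℂ} {a b : ℝ} (hF : ∀ t, F t ≠ 0 → t ∈ Icc a b) : tsupport F ⊆ Icc a b :=
  (isClosed_Icc.closure_subset_iff).2 fun t ht ↦ hF t (Function.mem_support.1 ht)
/-- A test function on `[a, b]`: nonzero values live in `[a, b]`. -/
theorem mem_Icc_of_apply_ne_zero {F : ℝ → ℂ} {a b : ℝ} (hF : tsupport F ⊆ Icc a b) {t : ℝ} (ht : F t ≠ 0) : t ∈ Icc a b :=
  hF (subset_tsupport _ (Function.mem_support.2 ht))

/-- **Sub-additivity under positivity.** If `Q_S ≥ 0` on `C(c)` and `f, g` are test functions on `[−c, c]`, then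
`Re Q_S(f + g) ≤ 2·Re Q_S(f) + 2·Re Q_S(g)` — the parallelogram law `Q(f+g) + Q(f−g) = 2Q(f) + 2Q(g)` with `Re Q_S(f − g) ≥ 0`. -/
theorem re_weilSemilocalQuadratic_add_le (hpos : WeilSemilocalPositivityOn S c) (hf : IsWeilTest f) (hg : IsWeilTest g)
    (hfs : tsupport f ⊆ Icc (-c) c) (hgs : tsupport g ⊆ Icc (-c) c) :
    (weilSemilocalQuadratic S (f + g)).re ≤ 2 * (weilSemilocalQuadratic S f).re + 2 * (weilSemilocalQuadratic S g).re := by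
  have hng : IsWeilTest (-g) := by convert hg.const_mul (-1) using 1; funext t; simp
  have h1 := weilSemilocalQuadratic_add S hf hg
  have h2 := weilSemilocalQuadratic_add S hf hng
  have hreflect : weilReflect (-g) = -weilReflect g := by funext t; simp [weilReflect]
  have hcl : weilConv f (weilReflect (-g)) = -weilConv f (weilReflect g) := by
    rw [hreflect]; have e : -weilReflect g = fun t ↦ (-1 : ℂ) * weilReflect g t := by funext t; simp
    rw [e, weilConv_const_mul_right]; funext t; simp
  have hcr : weilConv (-g) (weilReflect f) = -weilConv g (weilReflect f) := by
    have e : -g = fun t ↦ (-1 : ℂ) * g t := by funext t; simp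
    rw [e, weilConv_const_mul_left]; funext t; simp
  have hWn : ∀ K : ℝ → ℂ, weilSemilocalFunctional S (-K) = -weilSemilocalFunctional S K := fun K ↦ by
    have e : -K = fun t ↦ (-1 : ℂ) * K t := by funext t; simp
    rw [e, weilSemilocalFunctional_const_mul, neg_one_mul]
  -- `Q_S(−g) = Q_S(g)` (the tree's `SemilocalDeletionDipoleHalfRoom.weilSemilocalQuadratic_neg`, inlined: no hub olean yet)
  have hQneg : weilSemilocalQuadratic S (-g) = weilSemilocalQuadratic S g := by
    rw [show -g = fun t ↦ (-1 : ℂ) * g t by funext t; simp, weilSemilocalQuadratic_const_mul]; simp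
  rw [hQneg, hcl, hcr, hWn, hWn] at h2
  have hsupp : tsupport (f + -g) ⊆ Icc (-c) c := by
    refine tsupport_subset_Icc_of_apply fun t ht ↦ ?_
    by_cases hft : f t = 0
    · have : g t ≠ 0 := fun h0 ↦ ht (by simp [hft, h0])
      exact mem_Icc_of_apply_ne_zero hgs this
    · exact mem_Icc_of_apply_ne_zero hfs hft
  have h0 := hpos _ (hf.add hng) hsupp
  have e := congrArg Complex.re h1
  have e2 := congrArg Complex.re h2
  simp only [Complex.add_re, Complex.neg_re] at e e2 h0
  linarith

/-- The same with the gap given as a positive multiple of `L > 2δ` (either orientation). -/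
theorem mul_conj_eq_zero_of_gap (hsupp : tsupport h ⊆ Icc (-δ) δ) (hL : 2 * δ < L) {a b : ℝ} (n : ℕ) (hn : 1 ≤ n)
    (hab : a - b = n * L ∨ b - a = n * L) : h a * conj (h b) = 0 := by
  by_cases ha : h a = 0; · rw [ha, zero_mul]
  have hδ0 : 0 ≤ δ := by have := mem_Icc_of_apply_ne_zero hsupp ha; rw [mem_Icc] at this; linarith
  refine SemilocalDeletionDipole.mul_conj_eq_zero_of_far hsupp ?_
  have hn1 : (1 : ℝ) ≤ n := by exact_mod_cast hn
  have hLn : L ≤ n * L := by nlinarith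
  rcases hab with e | e
  · rw [e, abs_of_nonneg (by nlinarith)]; linarith
  · rw [abs_sub_comm, e, abs_of_nonneg (by nlinarith)]; linarith

/-! ## §2  The three-block comb `g = v₀h(· + L) + v₁h + v₂h(· − L)`: support, norm, `Q_S`-cost, autocorrelations at `±L, ±2L` -/

variable {v₀ v₁ v₂ : ℝ}

/-- The comb is a test function on `[−(L + δ), L + δ]`. -/
theorem comb_isWeilTest_tsupport (hh : IsWeilTest h) (hsupp : tsupport h ⊆ Icc (-δ) δ) (hL : 0 ≤ L) (v₀ v₁ v₂ : ℝ) :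
    IsWeilTest ((fun t ↦ (v₀ : ℂ) * h (t + L)) + (fun t ↦ (v₁ : ℂ) * h t) + fun t ↦ (v₂ : ℂ) * h (t - L)) ∧
      tsupport ((fun t ↦ (v₀ : ℂ) * h (t + L)) + (fun t ↦ (v₁ : ℂ) * h t) + fun t ↦ (v₂ : ℂ) * h (t - L)) ⊆
        Icc (-(L + δ)) (L + δ) := by
  refine ⟨(((isWeilTest_translate hh L).const_mul v₀).add (hh.const_mul v₁)).add ((hh.weilTranslate L).const_mul v₂), ?_⟩
  refine tsupport_subset_Icc_of_apply fun t ht ↦ ?_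
  simp only [Pi.add_apply] at ht
  rw [mem_Icc]
  by_cases h0 : h (t + L) = 0
  · by_cases h1 : h t = 0
    · have := mem_Icc_of_apply_ne_zero hsupp (fun h2 ↦ ht (by simp [h0, h1, h2]) : h (t - L) ≠ 0)
      rw [mem_Icc] at this; constructor <;> linarith
    · have := mem_Icc_of_apply_ne_zero hsupp h1; rw [mem_Icc] at this; constructor <;> linarith
  · have := mem_Icc_of_apply_ne_zero hsupp h0; rw [mem_Icc] at this; constructor <;> linarith

/-- `Q_S` of a scaled translate: `Q_S(v·h(· + a)) = v²·Q_S(h)` for real `v`. -/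
theorem weilSemilocalQuadratic_smul_translate (S : Finset ℕ) (h : ℝ → ℂ) (v a : ℝ) :
    weilSemilocalQuadratic S (fun t ↦ (v : ℂ) * h (t + a)) = ((v ^ 2 : ℝ) : ℂ) * weilSemilocalQuadratic S h := by
  rw [weilSemilocalQuadratic_const_mul, Complex.normSq_ofReal]
  unfold weilSemilocalQuadratic
  rw [weilConv_weilReflect_translate]; push_cast; ring

/-- **The comb costs at most four blocks per unit mass**: under `Q_S ≥ 0` on `C(L + δ)`, for `h ∈ C(δ)`, `L ≥ 0`:
`Re Q_S(g) ≤ 4(v₀² + v₁² + v₂²)·Re Q_S(h)`. -/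
theorem re_weilSemilocalQuadratic_comb_le (hh : IsWeilTest h) (hsupp : tsupport h ⊆ Icc (-δ) δ) (hL : 0 ≤ L)
    (hpos : WeilSemilocalPositivityOn S (L + δ)) (v₀ v₁ v₂ : ℝ) :
    (weilSemilocalQuadratic S ((fun t ↦ (v₀ : ℂ) * h (t + L)) + (fun t ↦ (v₁ : ℂ) * h t) + fun t ↦ (v₂ : ℂ) * h (t - L))).re ≤
      4 * (v₀ ^ 2 + v₁ ^ 2 + v₂ ^ 2) * (weilSemilocalQuadratic S h).re := by
  have hu0 : IsWeilTest (fun t ↦ (v₀ : ℂ) * h (t + L)) := (isWeilTest_translate hh L).const_mul v₀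
  have hu1 : IsWeilTest (fun t ↦ (v₁ : ℂ) * h t) := hh.const_mul v₁
  have hu2 : IsWeilTest (fun t ↦ (v₂ : ℂ) * h (t - L)) := (hh.weilTranslate L).const_mul v₂
  have hsa : ∀ (v a : ℝ), |a| ≤ L → tsupport (fun t ↦ (v : ℂ) * h (t + a)) ⊆ Icc (-(L + δ)) (L + δ) := fun v a ha ↦
    tsupport_subset_Icc_of_apply fun t ht ↦ by
      have := mem_Icc_of_apply_ne_zero hsupp (right_ne_zero_of_mul ht); rw [abs_le] at ha; rw [mem_Icc] at this ⊢
      constructor <;> linarith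
  have hs0 := hsa v₀ L (by rw [abs_of_nonneg hL])
  have hs1 : tsupport (fun t ↦ (v₁ : ℂ) * h t) ⊆ Icc (-(L + δ)) (L + δ) := by simpa using hsa v₁ 0 (by rw [abs_zero]; exact hL)
  have hs2 : tsupport (fun t ↦ (v₂ : ℂ) * h (t - L)) ⊆ Icc (-(L + δ)) (L + δ) := by
    simpa [sub_eq_add_neg] using hsa v₂ (-L) (by rw [abs_neg, abs_of_nonneg hL])
  have hs01 : tsupport ((fun t ↦ (v₀ : ℂ) * h (t + L)) + fun t ↦ (v₁ : ℂ) * h t) ⊆ Icc (-(L + δ)) (L + δ) :=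
    tsupport_subset_Icc_of_apply fun t ht ↦ by
      simp only [Pi.add_apply] at ht
      by_cases h0 : (v₀ : ℂ) * h (t + L) = 0
      · exact mem_Icc_of_apply_ne_zero hs1 (fun h1 ↦ ht (by rw [h0, zero_add]; exact h1))
      · exact mem_Icc_of_apply_ne_zero hs0 h0
  have hA := re_weilSemilocalQuadratic_add_le hpos (hu0.add hu1) hu2 hs01 hs2
  have hB := re_weilSemilocalQuadratic_add_le hpos hu0 hu1 hs0 hs1
  have e0 := congrArg Complex.re (weilSemilocalQuadratic_smul_translate S h v₀ L)
  have e1 : (weilSemilocalQuadratic S fun t ↦ (v₁ : ℂ) * h t).re = v₁ ^ 2 * (weilSemilocalQuadratic S h).re := by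
    have := congrArg Complex.re (weilSemilocalQuadratic_smul_translate S h v₁ 0)
    simp only [add_zero, Complex.re_ofReal_mul] at this; exact this
  have e2 : (weilSemilocalQuadratic S fun t ↦ (v₂ : ℂ) * h (t - L)).re = v₂ ^ 2 * (weilSemilocalQuadratic S h).re := by
    have := congrArg Complex.re (weilSemilocalQuadratic_smul_translate S h v₂ (-L))
    simp only [← sub_eq_add_neg, Complex.re_ofReal_mul] at this; exact this
  rw [Complex.re_ofReal_mul] at e0
  have hQ0 : 0 ≤ (weilSemilocalQuadratic S h).re :=
    hpos h hh (hsupp.trans (Icc_subset_Icc (by linarith) (by linarith)))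
  nlinarith [sq_nonneg v₂, hA, hB, e0, e1, e2]

/-- **Norm of the comb**: `‖g‖₂² = (v₀² + v₁² + v₂²)‖h‖₂²` (`2δ < L`: the blocks are disjoint). -/
theorem integral_norm_sq_comb (hh : IsWeilTest h) (hsupp : tsupport h ⊆ Icc (-δ) δ) (hL : 2 * δ < L) (v₀ v₁ v₂ : ℝ) :
    ∫ u : ℝ, ‖((fun t ↦ (v₀ : ℂ) * h (t + L)) + (fun t ↦ (v₁ : ℂ) * h t) + fun t ↦ (v₂ : ℂ) * h (t - L)) u‖ ^ 2 =
      (v₀ ^ 2 + v₁ ^ 2 + v₂ ^ 2) * ∫ u : ℝ, ‖h u‖ ^ 2 := by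
  have hpt : ∀ u : ℝ, ‖((fun t ↦ (v₀ : ℂ) * h (t + L)) + (fun t ↦ (v₁ : ℂ) * h t) + fun t ↦ (v₂ : ℂ) * h (t - L)) u‖ ^ 2 =
      v₀ ^ 2 * ‖h (u + L)‖ ^ 2 + v₁ ^ 2 * ‖h u‖ ^ 2 + v₂ ^ 2 * ‖h (u - L)‖ ^ 2 := by
    intro u
    simp only [Pi.add_apply]
    have z01 := mul_conj_eq_zero_of_gap hsupp hL 1 le_rfl (a := u + L) (b := u) (Or.inl (by push_cast; ring))
    have z10 := mul_conj_eq_zero_of_gap hsupp hL 1 le_rfl (a := u) (b := u + L) (Or.inr (by push_cast; ring))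
    have z02 := mul_conj_eq_zero_of_gap hsupp hL 2 (by norm_num) (a := u + L) (b := u - L) (Or.inl (by push_cast; ring))
    have z20 := mul_conj_eq_zero_of_gap hsupp hL 2 (by norm_num) (a := u - L) (b := u + L) (Or.inr (by push_cast; ring))
    have z12 := mul_conj_eq_zero_of_gap hsupp hL 1 le_rfl (a := u) (b := u - L) (Or.inl (by push_cast; ring))
    have z21 := mul_conj_eq_zero_of_gap hsupp hL 1 le_rfl (a := u - L) (b := u) (Or.inr (by push_cast; ring))
    have key : ((v₀ : ℂ) * h (u + L) + (v₁ : ℂ) * h u + (v₂ : ℂ) * h (u - L)) *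
        conj ((v₀ : ℂ) * h (u + L) + (v₁ : ℂ) * h u + (v₂ : ℂ) * h (u - L)) =
        ((v₀ ^ 2 * ‖h (u + L)‖ ^ 2 + v₁ ^ 2 * ‖h u‖ ^ 2 + v₂ ^ 2 * ‖h (u - L)‖ ^ 2 : ℝ) : ℂ) := by
      rw [← Complex.normSq_eq_norm_sq, ← Complex.normSq_eq_norm_sq, ← Complex.normSq_eq_norm_sq]
      push_cast
      rw [← Complex.mul_conj, ← Complex.mul_conj, ← Complex.mul_conj]
      simp only [map_add, map_mul, Complex.conj_ofReal]
      linear_combination ((v₀ : ℂ) * v₁) * z01 + ((v₁ : ℂ) * v₀) * z10 + ((v₀ : ℂ) * v₂) * z02 + ((v₂ : ℂ) * v₀) * z20 +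
        ((v₁ : ℂ) * v₂) * z12 + ((v₂ : ℂ) * v₁) * z21
    have := congrArg Complex.re key
    rw [Complex.mul_conj, Complex.ofReal_re, Complex.ofReal_re] at this
    rw [← Complex.normSq_eq_norm_sq]; exact this
  simp_rw [hpt]
  have hi := hh.integrable_norm_sq
  have h1 : Integrable fun u : ℝ ↦ v₀ ^ 2 * ‖h (u + L)‖ ^ 2 := (hi.comp_add_right L).const_mul _
  have h2 : Integrable fun u : ℝ ↦ v₁ ^ 2 * ‖h u‖ ^ 2 := hi.const_mul _
  have h3 : Integrable fun u : ℝ ↦ v₂ ^ 2 * ‖h (u - L)‖ ^ 2 := (hi.comp_sub_right L).const_mul _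
  have h12 : Integrable fun u : ℝ ↦ v₀ ^ 2 * ‖h (u + L)‖ ^ 2 + v₁ ^ 2 * ‖h u‖ ^ 2 := h1.add h2
  rw [integral_add h12 h3, integral_add h1 h2, integral_const_mul, integral_const_mul, integral_const_mul,
    integral_add_right_eq_self (fun u : ℝ ↦ ‖h u‖ ^ 2) L, integral_sub_right_eq_self (fun u : ℝ ↦ ‖h u‖ ^ 2) L]
  ring

/-- `k(x) = ∫ φ(u) conj φ(u − x) du`. -/
theorem weilConv_weilReflect_apply' (φ : ℝ → ℂ) (x : ℝ) : weilConv φ (weilReflect φ) x = ∫ u, φ u * conj (φ (u - x)) := by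
  rw [weilConv_apply]; exact integral_congr_ae (Eventually.of_forall fun u ↦ by simp only [weilReflect, neg_sub])

/-- **Autocorrelations of the comb at the lags**: `k_g(L) + k_g(−L) = 2(v₀v₁ + v₁v₂)‖h‖₂²` and `k_g(2L) + k_g(−2L) = 2v₀v₂‖h‖₂²`. -/
theorem weilConv_weilReflect_comb (hh : IsWeilTest h) (hsupp : tsupport h ⊆ Icc (-δ) δ) (hL : 2 * δ < L) (v₀ v₁ v₂ : ℝ) :
    let g := (fun t ↦ (v₀ : ℂ) * h (t + L)) + (fun t ↦ (v₁ : ℂ) * h t) + fun t ↦ (v₂ : ℂ) * h (t - L)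
    weilConv g (weilReflect g) L + weilConv g (weilReflect g) (-L) =
        ((2 * (v₀ * v₁ + v₁ * v₂) * ∫ u : ℝ, ‖h u‖ ^ 2 : ℝ) : ℂ) ∧
      weilConv g (weilReflect g) (2 * L) + weilConv g (weilReflect g) (-(2 * L)) =
        ((2 * (v₀ * v₂) * ∫ u : ℝ, ‖h u‖ ^ 2 : ℝ) : ℂ) := by
  intro g
  have hi := hh.integrable_norm_sq
  have Z : ∀ (a b : ℝ) (n : ℕ), 1 ≤ n → (a - b = n * L ∨ b - a = n * L) → h a * conj (h b) = 0 :=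
    fun a b n hn hab ↦ mul_conj_eq_zero_of_gap hsupp hL n hn hab
  -- lag L
  have hL1 : weilConv g (weilReflect g) L = (((v₀ * v₁ + v₁ * v₂) * ∫ u : ℝ, ‖h u‖ ^ 2 : ℝ) : ℂ) := by
    rw [weilConv_weilReflect_apply']
    have hpt : ∀ u : ℝ, g u * conj (g (u - L)) = (((v₀ * v₁) * ‖h u‖ ^ 2 + (v₁ * v₂) * ‖h (u - L)‖ ^ 2 : ℝ) : ℂ) := by
      intro u
      simp only [g, Pi.add_apply]
      have e1 : u - L + L = u := by ring
      rw [e1]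
      have z1 := Z (u + L) u 1 le_rfl (Or.inl (by push_cast; ring))
      have z2 := Z (u + L) (u - L) 2 (by norm_num) (Or.inl (by push_cast; ring))
      have z3 := Z (u + L) (u - L - L) 3 (by norm_num) (Or.inl (by push_cast; ring))
      have z4 := Z u (u - L) 1 le_rfl (Or.inl (by push_cast; ring))
      have z5 := Z u (u - L - L) 2 (by norm_num) (Or.inl (by push_cast; ring))
      have z6 := Z (u - L) u 1 le_rfl (Or.inr (by push_cast; ring))
      have z7 := Z (u - L) (u - L - L) 1 le_rfl (Or.inl (by push_cast; ring))
      rw [← Complex.normSq_eq_norm_sq, ← Complex.normSq_eq_norm_sq]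
      push_cast
      rw [← Complex.mul_conj, ← Complex.mul_conj]
      simp only [map_add, map_mul, Complex.conj_ofReal]
      linear_combination ((v₀ : ℂ) * v₀) * z1 + ((v₀ : ℂ) * v₁) * z2 + ((v₀ : ℂ) * v₂) * z3 + ((v₁ : ℂ) * v₁) * z4 +
        ((v₁ : ℂ) * v₂) * z5 + ((v₂ : ℂ) * v₀) * z6 + ((v₂ : ℂ) * v₂) * z7
    simp_rw [hpt]
    have hA : Integrable fun u : ℝ ↦ v₀ * v₁ * ‖h u‖ ^ 2 := hi.const_mul _
    have hB : Integrable fun u : ℝ ↦ v₁ * v₂ * ‖h (u - L)‖ ^ 2 := (hi.comp_sub_right L).const_mul _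
    rw [integral_complex_ofReal, integral_add hA hB, integral_const_mul, integral_const_mul,
      integral_sub_right_eq_self (fun u : ℝ ↦ ‖h u‖ ^ 2) L]
    push_cast; ring
  -- lag 2L
  have hL2 : weilConv g (weilReflect g) (2 * L) = (((v₀ * v₂) * ∫ u : ℝ, ‖h u‖ ^ 2 : ℝ) : ℂ) := by
    rw [weilConv_weilReflect_apply']
    have hpt : ∀ u : ℝ, g u * conj (g (u - 2 * L)) = (((v₀ * v₂) * ‖h (u - L)‖ ^ 2 : ℝ) : ℂ) := by
      intro u
      simp only [g, Pi.add_apply]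
      have e1 : u - 2 * L + L = u - L := by ring
      rw [e1]
      have z1 := Z (u + L) (u - L) 2 (by norm_num) (Or.inl (by push_cast; ring))
      have z2 := Z (u + L) (u - 2 * L) 3 (by norm_num) (Or.inl (by push_cast; ring))
      have z3 := Z (u + L) (u - 2 * L - L) 4 (by norm_num) (Or.inl (by push_cast; ring))
      have z4 := Z u (u - L) 1 le_rfl (Or.inl (by push_cast; ring))
      have z5 := Z u (u - 2 * L) 2 (by norm_num) (Or.inl (by push_cast; ring))
      have z6 := Z u (u - 2 * L - L) 3 (by norm_num) (Or.inl (by push_cast; ring))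
      have z7 := Z (u - L) (u - 2 * L) 1 le_rfl (Or.inl (by push_cast; ring))
      have z8 := Z (u - L) (u - 2 * L - L) 2 (by norm_num) (Or.inl (by push_cast; ring))
      rw [← Complex.normSq_eq_norm_sq]
      push_cast
      rw [← Complex.mul_conj]
      simp only [map_add, map_mul, Complex.conj_ofReal]
      linear_combination ((v₀ : ℂ) * v₀) * z1 + ((v₀ : ℂ) * v₁) * z2 + ((v₀ : ℂ) * v₂) * z3 + ((v₁ : ℂ) * v₀) * z4 +
        ((v₁ : ℂ) * v₁) * z5 + ((v₁ : ℂ) * v₂) * z6 + ((v₂ : ℂ) * v₁) * z7 + ((v₂ : ℂ) * v₂) * z8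
    simp_rw [hpt]
    rw [integral_complex_ofReal, integral_const_mul, integral_sub_right_eq_self (fun u : ℝ ↦ ‖h u‖ ^ 2) L]
  have hneg : ∀ x : ℝ, weilConv g (weilReflect g) (-x) = conj (weilConv g (weilReflect g) x) := fun x ↦ by
    rw [← conj_weilConv_weilReflect_neg g x, Complex.conj_conj]
  refine ⟨?_, ?_⟩
  · rw [hneg, hL1, Complex.conj_ofReal]; push_cast; ring
  · rw [hneg, hL2, Complex.conj_ofReal]; push_cast; ring

/-! ## §3  The half-room law for two atoms -/
/-- **Comb test, any coefficients.** `p ∈ S` prime, `L = log p`, `h ∈ C(δ)` with `2δ < L`, `Q_S ≥ 0` on `C(L + δ)`, and a constraint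
`P` satisfied by every positive multiple of the comb: `λ_min(S∖{p}; L + δ; P)·(v₀²+v₁²+v₂²)‖h‖₂² ≤
4(v₀²+v₁²+v₂²)·Re Q_S(h) + (2w₁(v₀v₁ + v₁v₂) + 2w₂v₀v₂)‖h‖₂²` — the Rayleigh quotient of the comb in the DELETED form. -/
theorem semilocalGroundEnergy_erase_comb_le (hh : IsWeilTest h) (hsupp : tsupport h ⊆ Icc (-δ) δ) (hp : p.Prime)
    (hpS : p ∈ S) (hδ : 2 * δ < Real.log p) (hpos : WeilSemilocalPositivityOn S (Real.log p + δ)) (v₀ v₁ v₂ : ℝ)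
    (hP : ∀ a : ℝ, 0 < a → P fun t ↦ (a : ℂ) *
      (((fun t ↦ (v₀ : ℂ) * h (t + Real.log p)) + (fun t ↦ (v₁ : ℂ) * h t) + fun t ↦ (v₂ : ℂ) * h (t - Real.log p)) t)) :
    semilocalGroundEnergy (S.erase p) P (Real.log p + δ) * ((v₀ ^ 2 + v₁ ^ 2 + v₂ ^ 2) * ∫ u : ℝ, ‖h u‖ ^ 2) ≤
      4 * (v₀ ^ 2 + v₁ ^ 2 + v₂ ^ 2) * (weilSemilocalQuadratic S h).re +
        (2 * (Real.log p / Real.sqrt p) * (v₀ * v₁ + v₁ * v₂) + 2 * (Real.log p / p) * (v₀ * v₂)) * ∫ u : ℝ, ‖h u‖ ^ 2 := by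
  set L := Real.log p with hLdef
  have hL0 : 0 < L := Real.log_pos (by exact_mod_cast hp.one_lt)
  have hp0 : (0 : ℝ) < p := by exact_mod_cast hp.pos
  set g := (fun t ↦ (v₀ : ℂ) * h (t + L)) + (fun t ↦ (v₁ : ℂ) * h t) + fun t ↦ (v₂ : ℂ) * h (t - L) with hgdef
  obtain ⟨hg, hgs⟩ := comb_isWeilTest_tsupport hh hsupp hL0.le v₀ v₁ v₂
  -- Rayleigh bound in the deleted form
  have hR := semilocalGroundEnergy_mul_le_re (S := S.erase p) (P := P) hg hgs hP
  -- the deletion identity with m = 2 and the comb's autocorrelations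
  have hm : 2 * (L + δ) < ((2 : ℕ) + 1) * Real.log p := by push_cast; linarith
  have hid := weilSemilocalQuadratic_sub_erase_pow hg hp hpS hgs hm
  obtain ⟨k1, k2⟩ := weilConv_weilReflect_comb hh hsupp hδ v₀ v₁ v₂ (L := L)
  simp only [Finset.sum_range_succ, Finset.sum_range_zero, zero_add, Nat.cast_zero, Nat.cast_one, pow_one, one_mul,
    one_add_one_eq_two] at hid
  have hsq : Real.sqrt ((p : ℝ) ^ 2) = p := Real.sqrt_sq hp0.le
  rw [← hLdef, hsq, k1, k2] at hid
  have hre := congrArg Complex.re hid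
  simp only [Complex.sub_re, Complex.neg_re, Complex.add_re, Complex.re_ofReal_mul, Complex.ofReal_re] at hre
  -- cost of the comb and its norm
  have hcost := re_weilSemilocalQuadratic_comb_le hh hsupp hL0.le hpos v₀ v₁ v₂
  rw [integral_norm_sq_comb hh hsupp hδ] at hR
  nlinarith [hR, hcost, hre]

/-- The bottom eigenvector `(1, −β, 1)`, `β = 2w₁/μ₂`, of `A₂(p)`: `vᵀA₂v = −μ₂|v|²`, from the root equation `μ₂(μ₂ + w₂) = 2w₁²`. -/
theorem bottom_eigenvector_two {μ w₁ w₂ : ℝ} (hμ : 0 < μ) (hroot : μ * (μ + w₂) = 2 * w₁ ^ 2) :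
    2 * w₁ * (1 * -(2 * w₁ / μ) + -(2 * w₁ / μ) * 1) + 2 * w₂ * (1 * 1) =
      -μ * (1 ^ 2 + (-(2 * w₁ / μ)) ^ 2 + 1 ^ 2) := by
  field_simp
  nlinarith [hroot]

/-- The algebra of `μ₂(p)`: positivity and the root equation. -/
theorem mu_two_root {p : ℕ} (hp : p.Prime) :
    0 < Real.log p / (2 * p) * (Real.sqrt (1 + 8 * p) - 1) ∧
      Real.log p / (2 * p) * (Real.sqrt (1 + 8 * p) - 1) * (Real.log p / (2 * p) * (Real.sqrt (1 + 8 * p) - 1) + Real.log p / p) =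
        2 * (Real.log p / Real.sqrt p) ^ 2 := by
  have hp0 : (0 : ℝ) < p := by exact_mod_cast hp.pos
  have hp1 : (1 : ℝ) ≤ p := by exact_mod_cast hp.one_lt.le
  have hL : 0 < Real.log p := Real.log_pos (by exact_mod_cast hp.one_lt)
  set s := Real.sqrt (1 + 8 * p) with hsdef
  have hs2 : s ^ 2 = 1 + 8 * p := Real.sq_sqrt (by positivity)
  have hs3 : 3 ≤ s := by
    rw [hsdef, show (3 : ℝ) = Real.sqrt (3 ^ 2) by rw [Real.sqrt_sq (by norm_num)]]
    exact Real.sqrt_le_sqrt (by nlinarith)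
  have hsp : Real.sqrt p ^ 2 = p := Real.sq_sqrt hp0.le
  refine ⟨mul_pos (div_pos hL (by positivity)) (by linarith), ?_⟩
  calc Real.log p / (2 * p) * (s - 1) * (Real.log p / (2 * p) * (s - 1) + Real.log p / p)
      = Real.log p ^ 2 * (s ^ 2 - 1) / (4 * p ^ 2) := by field_simp; ring
    _ = 2 * (Real.log p / Real.sqrt p) ^ 2 := by rw [hs2, div_pow, hsp]; field_simp; ring

/-- The comb of an EVEN block with symmetric coefficients is even; of an ODD block, odd. -/
theorem comb_parity (a : ℝ) (v₀ v₁ : ℝ) :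
    ((∀ t, h (-t) = h t) → ∀ t, (a : ℂ) * (((fun t ↦ (v₀ : ℂ) * h (t + L)) + (fun t ↦ (v₁ : ℂ) * h t) +
        fun t ↦ (v₀ : ℂ) * h (t - L)) (-t)) =
      (a : ℂ) * (((fun t ↦ (v₀ : ℂ) * h (t + L)) + (fun t ↦ (v₁ : ℂ) * h t) + fun t ↦ (v₀ : ℂ) * h (t - L)) t)) ∧
    ((∀ t, h (-t) = -h t) → ∀ t, (a : ℂ) * (((fun t ↦ (v₀ : ℂ) * h (t + L)) + (fun t ↦ (v₁ : ℂ) * h t) +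
        fun t ↦ (v₀ : ℂ) * h (t - L)) (-t)) =
      -((a : ℂ) * (((fun t ↦ (v₀ : ℂ) * h (t + L)) + (fun t ↦ (v₁ : ℂ) * h t) + fun t ↦ (v₀ : ℂ) * h (t - L)) t))) := by
  constructor
  · intro heven t
    simp only [Pi.add_apply]
    rw [show -t + L = -(t - L) by ring, show -t - L = -(t + L) by ring, heven, heven, heven]; ring
  · intro hodd t
    simp only [Pi.add_apply]
    rw [show -t + L = -(t - L) by ring, show -t - L = -(t + L) by ring, hodd, hodd, hodd]; ring

/-- The half-room law for a constraint `P` on the deleted side fed by blocks with constraint `P'` (shared step: the inf over blocks). -/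
theorem semilocalGroundEnergy_erase_le_two_of (hp : p.Prime) (hpS : p ∈ S) (hδ : 2 * δ < Real.log p)
    (hpos : WeilSemilocalPositivityOn S (Real.log p + δ)) {P P' : (ℝ → ℂ) → Prop}
    (hne : (semilocalSphereValues S P' δ).Nonempty)
    (hPP : ∀ g : ℝ → ℂ, P' g → ∀ a : ℝ, 0 < a → P fun t ↦ (a : ℂ) *
      (((fun t ↦ ((1 : ℝ) : ℂ) * g (t + Real.log p)) +
        (fun t ↦ ((-(2 * (Real.log p / Real.sqrt p) / (Real.log p / (2 * p) * (Real.sqrt (1 + 8 * p) - 1))) : ℝ) : ℂ) * g t) +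
        fun t ↦ ((1 : ℝ) : ℂ) * g (t - Real.log p)) t)) :
    semilocalGroundEnergy (S.erase p) P (Real.log p + δ) ≤
      -(Real.log p / (2 * p) * (Real.sqrt (1 + 8 * p) - 1)) + 4 * semilocalGroundEnergy S P' δ := by
  obtain ⟨hμ, hroot⟩ := mu_two_root hp
  set μ := Real.log p / (2 * p) * (Real.sqrt (1 + 8 * p) - 1) with hμdef
  have hv := bottom_eigenvector_two hμ hroot
  have key : (semilocalGroundEnergy (S.erase p) P (Real.log p + δ) + μ) / 4 ≤ semilocalGroundEnergy S P' δ := by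
    refine le_semilocalGroundEnergy hne fun g hg hs hPg hn ↦ ?_
    have := semilocalGroundEnergy_erase_comb_le (P := P) hg hs hp hpS hδ hpos 1 (-(2 * (Real.log p / Real.sqrt p) / μ)) 1
      (hPP g hPg)
    rw [hn, mul_one, mul_one] at this
    have hn2 : 0 < 1 ^ 2 + (-(2 * (Real.log p / Real.sqrt p) / μ)) ^ 2 + 1 ^ 2 := by positivity
    nlinarith [hv, this, hn2]
  linarith

/-- **THE TWO-ATOM HALF-ROOM LAW, all sectors.**  `p ∈ S` prime, `0 < δ`, `2δ < log p`, `Q_S ≥ 0` on `C(log p + δ)`: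
`λ_min(S∖{p}; log p + δ) ≤ −μ₂(p) + 4·λ_min(S; δ)`, `μ₂(p) = (log p/(2p))(√(1+8p) − 1)`. -/
theorem semilocalGroundEnergy_erase_top_le_two (hp : p.Prime) (hpS : p ∈ S) (hδ0 : 0 < δ) (hδ : 2 * δ < Real.log p)
    (hpos : WeilSemilocalPositivityOn S (Real.log p + δ)) :
    semilocalGroundEnergy (S.erase p) (fun _ ↦ True) (Real.log p + δ) ≤
      -(Real.log p / (2 * p) * (Real.sqrt (1 + 8 * p) - 1)) + 4 * semilocalGroundEnergy S (fun _ ↦ True) δ :=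
  semilocalGroundEnergy_erase_le_two_of hp hpS hδ hpos (semilocalSphereValues_top_nonempty S hδ0) fun _ _ _ _ ↦ trivial

/-- **THE TWO-ATOM HALF-ROOM LAW, even sector ← even blocks** (no parity swap for two atoms):
`λ_min(S∖{p}; log p + δ; even) ≤ −μ₂(p) + 4·λ_min(S; δ; even)`. -/
theorem semilocalGroundEnergy_erase_even_le_two (hp : p.Prime) (hpS : p ∈ S) (hδ0 : 0 < δ) (hδ : 2 * δ < Real.log p)
    (hpos : WeilSemilocalPositivityOn S (Real.log p + δ)) :
    semilocalGroundEnergy (S.erase p) (fun g ↦ ∀ t, g (-t) = g t) (Real.log p + δ) ≤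
      -(Real.log p / (2 * p) * (Real.sqrt (1 + 8 * p) - 1)) + 4 * semilocalGroundEnergy S (fun g ↦ ∀ t, g (-t) = g t) δ :=
  semilocalGroundEnergy_erase_le_two_of hp hpS hδ hpos (semilocalSphereValues_even_nonempty S hδ0)
    fun g hPg a _ ↦ (comb_parity (h := g) (L := Real.log p) a 1 _).1 hPg

/-- **THE TWO-ATOM HALF-ROOM LAW, odd sector ← odd blocks**: `λ_min(S∖{p}; log p + δ; odd) ≤ −μ₂(p) + 4·λ_min(S; δ; odd)`. -/
theorem semilocalGroundEnergy_erase_odd_le_two (hp : p.Prime) (hpS : p ∈ S) (hδ0 : 0 < δ) (hδ : 2 * δ < Real.log p)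
    (hpos : WeilSemilocalPositivityOn S (Real.log p + δ)) :
    semilocalGroundEnergy (S.erase p) (fun g ↦ ∀ t, g (-t) = -g t) (Real.log p + δ) ≤
      -(Real.log p / (2 * p) * (Real.sqrt (1 + 8 * p) - 1)) + 4 * semilocalGroundEnergy S (fun g ↦ ∀ t, g (-t) = -g t) δ :=
  semilocalGroundEnergy_erase_le_two_of hp hpS hδ hpos (semilocalSphereValues_odd_nonempty S hδ0)
    fun g hPg a _ ↦ (comb_parity (h := g) (L := Real.log p) a 1 _).2 hPg
end Summit.RiemannHypothesis.RiemannHypothesis.Theorems.SemilocalDeletionToeplitzHalfRoom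

end
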